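import Summits.NavierStokesRegularity.NavierStokesRegularity.Theses.HodographBetchov
import Summits.NavierStokesRegularity.NavierStokesRegularity.Theorems.FastClassSqueeze.Negative.FalseWithoutLerayHopf
import Literature.Analysis.FluidPDE.NSQuasipotential
import Literature.Analysis.FluidPDE.LerayGaugeStrainSpectrum
import Literature.Analysis.FluidPDE.TaoClassGlobal
import Literature.Analysis.FluidPDE.LerayLocalRegularH1Proofs

/-!
# Crux `FastClassSqueeze` (stmt-NavierStokesRegularity-15832): the registered stub
# `stub_pointSqueeze_of_subscale` is false as stated (negative-time junk)

Route `HodographBetchov`, crux 3, picked line `Sketch-ideasK1` / `resolved-weyl-split` (skeleton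
registered 2026-08-17T12:32Z, stubs `stub_pointSubscaleSqueeze`, `stub_pointSqueeze_of_subscale`,
`stub_germ_of_pointSqueeze`). Refuter crux-disprover, `-- Targets` lane.

`stub_pointSqueeze_of_subscale` (local Weyl assembly) says: for every classical solution `(u, p)` of
unforced Navier–Stokes on `ℝ³ × [0,T)` that is Leray–Hopf on `[0,T]` from `u 0`, and for ALL
`x₀ : ℝ³` and ALL REAL `r R τ l q` with `0 < l`, `3 ≤ q`: if the SUBSCALE middle principal strain
`λ₁(∇u(t,x) − ⨍_{B̄(x,R)} ∇u(t,·))` has finite Miller functional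
`∫_{τ}^{T} (∫_{{|u(t)|>l} ∩ B(x₀,r)} (λ₁⁺)^q)^{2/(2q−3)} dt < ∞`, then so has the FULL middle strain
`λ₁(∇u(t,x))` on the same set and the same time interval `(τ, T)`.

**It is false**: the time `τ` is universally quantified over `ℝ` and both functionals integrate over
`Set.Ioo τ T`, but NOTHING in the hypotheses constrains the field `u t` at times `t < 0`
(`IsClassicalNSSolutionOn (Ico 0 T)` sees `t ∈ [0,T)` and the one-sided time derivative within
`[0,T)`; every clause of `IsLerayHopfOn T` lives on `t ∈ (0,T)`, `[0,T]`, `(0,T]` or `𝓝[>] 0`).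
Witness (`ν = T = 1`): `u = junkVel`, the REST STATE `u ≡ 0`, `p ≡ 0` for `t ≥ 0` (classical and
Leray–Hopf: tree lemmas `isClassicalNSSolutionOn_zero`, `isLerayHopfOn_zero`, transported along
`IsClassicalNSSolutionOn.congr_slices`, `IsLerayHopfOn.congr_ae_slices`), and for `t < 0` the
LINEAR biaxial strain `u(t, x) = (−t)⁻¹ B x`, `B = diag(1, 1, −2)` (`strainB` of the landed
`FalseWithoutLerayHopf`). A linear slice has CONSTANT gradient, so its subscale gradient
`∇u − ⨍_{B̄(x,1)} ∇u` vanishes identically and the hypothesis functional is `0 < ∞` (for every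
`τ`); but the full middle strain of `(−t)⁻¹ B` is `(−t)⁻¹` (`le_strainEigenvalues_smul_strainB`,
Courant–Fischer on the plane `{ξ₂ = 0}`), the whole ball `B(3e₀, 1)` is fast (`|u| > 2 > l = 1`) for
`t ∈ (−1, 0)`, and with `q = 3` the conclusion's integrand is `≍ (−t)⁻²`, not integrable at `0⁻`:
the conclusion functional over `(τ, T) = (−1, 1)` is `∞`.

Classification: stub-MISSTATED (cheap repair). Corrected signature: add the hypothesis `0 ≤ τ`
(equivalently integrate over `Set.Ioo (max τ 0) T`), i.e.
`… ∀ (x₀) (r R τ l q : ℝ), 0 ≤ τ → 0 < l → 3 ≤ q → (subscale functional on Ioo τ T < ⊤) →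
(full functional on Ioo τ T < ⊤)`; the witness does not bite the repaired stub (for `t ≥ 0` it is
the rest state), and the repaired stub is the landed a-priori Weyl split B2 localised to a ball
(resolved part `⨍_{B̄(x,R)}∇u ∈ L²_t L^∞_x` by the energy class, `q ≥ 3 ⇒ p ≤ 2`). The assembly
should feed it `max τ 0` (monotonicity of the functional in the time interval) or stub 1 should
export `0 ≤ τ ∧ τ < T`.
[cite: MajdaBertozzi2002, §1.4 (exact solutions with linear velocity field)]
-/

noncomputable section

-- the summit and its single problem share the name `NavierStokesRegularity` (D-0017 nested layout)
set_option linter.dupNamespace false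

namespace Summit.NavierStokesRegularity.NavierStokesRegularity.Theorems.FastClassSqueeze.Negative

open MeasureTheory Set Filter Metric Topology Function InnerProductSpace
open scoped ENNReal NNReal RealInnerProductSpace ContDiff
open Literature.Analysis.FluidPDE

/-! ## The orthonormal pair `e₀, e₁` and the middle strain of `c • B` -/

/-- `e₀ ⊥ e₁`. [folklore] -/
theorem inner_ex_ey : ⟪ex, ey⟫ = 0 := by
  simp [ex, ey, EuclideanSpace.inner_single_left]

/-- The plane spanned by `e₀, e₁` is `{ξ₂ = 0}`. [folklore] -/
theorem combo_apply_two (α β : ℝ) : (α • ex + β • ey) 2 = 0 := by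
  simp [ex, ey]

/-- `‖α e₀ + β e₁‖² = α² + β²`. [folklore] -/
theorem norm_combo_sq (α β : ℝ) : ‖α • ex + β • ey‖ ^ 2 = α ^ 2 + β ^ 2 := by
  have hx : ‖ex‖ = 1 := by simp [ex]
  have hy : ‖ey‖ = 1 := by simp [ey]
  rw [norm_add_sq_real, real_inner_smul_left, real_inner_smul_right, inner_ex_ey, norm_smul,
    norm_smul, hx, hy]
  simp [sq_abs]

/-- **Lower Courant–Fischer bound for the scaled biaxial strain**: the middle principal strain of
`c • B`, `B = diag(1,1,−2)`, is at least `c` (it equals `c`): on the plane `{ξ₂ = 0}` the form of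
`c • B` is `c‖ξ‖²`. [cite: HornJohnson2013, Thm 4.2.6] -/
theorem le_strainEigenvalues_smul_strainB (c : ℝ) :
    c ≤ strainEigenvalues ((c • strainB : (EuclideanSpace ℝ (Fin 3)) →L[ℝ] (EuclideanSpace ℝ (Fin 3))) : (EuclideanSpace ℝ (Fin 3)) →ₗ[ℝ] (EuclideanSpace ℝ (Fin 3)))
      finrank_euclideanSpace_fin 1 := by
  rw [le_strainEigenvalues_mid_iff]
  refine ⟨ex, ey, by simp [ex], by simp [ey], inner_ex_ey, fun α β => ?_⟩
  show c * (α ^ 2 + β ^ 2) ≤ ⟪c • strainB (α • ex + β • ey), α • ex + β • ey⟫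
  rw [real_inner_smul_left, inner_strainB_self (combo_apply_two α β), norm_combo_sq]

/-- The middle principal strain of the zero gradient is `≤ 0` (it is `0`). [folklore] -/
theorem strainEigenvalues_zero_mid_le :
    strainEigenvalues (0 : (EuclideanSpace ℝ (Fin 3)) →ₗ[ℝ] (EuclideanSpace ℝ (Fin 3))) finrank_euclideanSpace_fin 1 ≤ 0 := by
  rw [strainEigenvalues_mid_le_iff]
  exact ⟨ex, ey, by simp [ex], by simp [ey], inner_ex_ey, fun α β => by simp⟩

/-! ## The witness: rest state for `t ≥ 0`, linear strain junk for `t < 0` -/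

/-- The witness field: `u(t) ≡ 0` for `t ≥ 0` (the rest state) and `u(t, x) = (−t)⁻¹ B x` for
`t < 0` — times at which no hypothesis of the stub looks. -/
def junkVel : ℝ → (EuclideanSpace ℝ (Fin 3)) → (EuclideanSpace ℝ (Fin 3)) := fun t x => if t < 0 then (-t)⁻¹ • strainB x else 0

/-- For `t ≥ 0` the witness is the rest state. [folklore] -/
theorem junkVel_of_nonneg {t : ℝ} (ht : 0 ≤ t) : junkVel t = 0 := by
  funext x
  simp [junkVel, not_lt.2 ht]

/-- For `t < 0` the witness slice is the linear map `(−t)⁻¹ B`. [folklore] -/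
theorem junkVel_of_neg {t : ℝ} (ht : t < 0) : junkVel t = ⇑((-t)⁻¹ • strainB) := by
  funext x
  simp [junkVel, ht]

/-- `∇u(t) ≡ (−t)⁻¹ B` for `t < 0`. [folklore] -/
theorem fderiv_junkVel_of_neg {t : ℝ} (ht : t < 0) (x : (EuclideanSpace ℝ (Fin 3))) :
    fderiv ℝ (junkVel t) x = (-t)⁻¹ • strainB := by
  rw [junkVel_of_neg ht, ContinuousLinearMap.fderiv]

/-- `∇u(t) ≡ 0` for `t ≥ 0`. [folklore] -/
theorem fderiv_junkVel_of_nonneg {t : ℝ} (ht : 0 ≤ t) (x : (EuclideanSpace ℝ (Fin 3))) : fderiv ℝ (junkVel t) x = 0 := by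
  rw [junkVel_of_nonneg ht]
  exact fderiv_const_apply 0

/-- Every slice of the witness has a gradient constant in space. [folklore] -/
theorem fderiv_junkVel_const (t : ℝ) (x y : (EuclideanSpace ℝ (Fin 3))) : fderiv ℝ (junkVel t) y = fderiv ℝ (junkVel t) x := by
  rcases lt_or_ge t 0 with ht | ht
  · rw [fderiv_junkVel_of_neg ht, fderiv_junkVel_of_neg ht]
  · rw [fderiv_junkVel_of_nonneg ht, fderiv_junkVel_of_nonneg ht]

/-- **The subscale gradient of the witness vanishes identically**: a constant gradient equals its
own average over every ball of positive radius. [folklore] -/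
theorem fderiv_junkVel_sub_setAverage (t : ℝ) (x : (EuclideanSpace ℝ (Fin 3))) {R : ℝ} (hR : 0 < R) :
    fderiv ℝ (junkVel t) x - ⨍ y in closedBall x R, fderiv ℝ (junkVel t) y = 0 := by
  rw [setAverage_congr_fun measurableSet_closedBall
      (Eventually.of_forall fun y _ => fderiv_junkVel_const t x y),
    setAverage_const (measure_closedBall_pos volume x hR).ne' measure_closedBall_lt_top.ne, sub_self]

/-- The witness is a classical solution of unforced Navier–Stokes on `[0,1) × ℝ³` (it is the rest
state there; `IsClassicalNSSolutionOn.congr_slices`). [folklore] -/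
theorem junkVel_isClassical (ν : ℝ) : IsClassicalNSSolutionOn (Ico 0 1) ν 0 junkVel 0 :=
  (isClassicalNSSolutionOn_zero (Ico (0 : ℝ) 1) ν).congr_slices
    (fun _ ht => junkVel_of_nonneg ht.1) (fun _ _ => rfl)

/-- The witness is Leray–Hopf on `[0,1]` from its datum `u 0 = 0` (it is the rest state there;
`IsLerayHopfOn.congr_ae_slices`). [folklore] -/
theorem junkVel_isLerayHopf (ν : ℝ) : IsLerayHopfOn 1 ν 0 (junkVel 0) junkVel := by
  rw [junkVel_of_nonneg le_rfl]
  refine (isLerayHopfOn_zero (E := (EuclideanSpace ℝ (Fin 3))) 1 ν).congr_ae_slices one_pos ?_ fun t ht => ?_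
  · refine (aestronglyMeasurable_const (b := (0 : (EuclideanSpace ℝ (Fin 3))))).congr ?_
    filter_upwards [ae_restrict_mem (measurableSet_Ioo.prod MeasurableSet.univ)] with z hz
    show (0 : (EuclideanSpace ℝ (Fin 3))) = junkVel z.1 z.2
    rw [junkVel_of_nonneg (le_of_lt hz.1.1)]
    rfl
  · rw [junkVel_of_nonneg ht.1]
    exact EventuallyEq.rfl

/-! ## The fast ball and the lower bound on the full middle strain -/

/-- The centre `3 e₀` of the fast ball. -/
def fastCentre : (EuclideanSpace ℝ (Fin 3)) := (3 : ℝ) • ex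

/-- Points of `B(3e₀, 1)` have norm `> 2`. [folklore] -/
theorem two_lt_norm_of_mem_ball {x : (EuclideanSpace ℝ (Fin 3))} (hx : x ∈ ball fastCentre 1) : 2 < ‖x‖ := by
  have h1 : ‖fastCentre‖ = 3 := by
    rw [fastCentre, norm_smul, Real.norm_eq_abs]
    simp [ex]
  have h2 : ‖x - fastCentre‖ < 1 := by rwa [mem_ball, dist_eq_norm] at hx
  have h3 : ‖fastCentre‖ ≤ ‖x‖ + ‖x - fastCentre‖ := by
    calc ‖fastCentre‖ = ‖x - (x - fastCentre)‖ := by rw [sub_sub_cancel]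
      _ ≤ ‖x‖ + ‖x - fastCentre‖ := norm_sub_le _ _
  linarith

/-- For `t ∈ (−1, 0)` the whole ball `B(3e₀, 1)` is fast at level `1`: `|u(t,x)| ≥ (−t)⁻¹‖x‖ > 2`.
[folklore] -/
theorem ball_subset_fast {t : ℝ} (ht : t ∈ Ioo (-1 : ℝ) 0) :
    ball fastCentre 1 ⊆ {x : (EuclideanSpace ℝ (Fin 3)) | 1 < ‖junkVel t x‖} := by
  intro x hx
  have hlam : 1 < (-t)⁻¹ := (one_lt_inv₀ (neg_pos.2 ht.2)).2 (by linarith [ht.1])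
  show 1 < ‖junkVel t x‖
  rw [junkVel_of_neg ht.2]
  show 1 < ‖(-t)⁻¹ • strainB x‖
  rw [norm_smul, Real.norm_eq_abs, abs_of_pos (inv_pos.2 (neg_pos.2 ht.2))]
  calc (1 : ℝ) < 2 := one_lt_two
    _ < ‖x‖ := two_lt_norm_of_mem_ball hx
    _ ≤ ‖strainB x‖ := norm_le_norm_strainB x
    _ = 1 * ‖strainB x‖ := (one_mul _).symm
    _ ≤ (-t)⁻¹ * ‖strainB x‖ := mul_le_mul_of_nonneg_right hlam.le (norm_nonneg _)

/-- **Lower bound on the conclusion's inner integral** for `t ∈ (−1, 0)`: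
`(ofReal (−t)⁻¹)³ · |B(3e₀,1)| ≤ ∫_{fast ∩ B(3e₀,1)} (λ₁⁺(∇u(t)))³`. [folklore] -/
theorem inner_lower_bound {t : ℝ} (ht : t ∈ Ioo (-1 : ℝ) 0) :
    ENNReal.ofReal ((-t)⁻¹) ^ (3 : ℝ) * volume (ball fastCentre 1) ≤
      ∫⁻ x in {x : (EuclideanSpace ℝ (Fin 3)) | 1 < ‖junkVel t x‖} ∩ ball fastCentre 1,
        ENNReal.ofReal (strainEigenvalues ((fderiv ℝ (junkVel t) x : (EuclideanSpace ℝ (Fin 3)) →L[ℝ] (EuclideanSpace ℝ (Fin 3))) : (EuclideanSpace ℝ (Fin 3)) →ₗ[ℝ] (EuclideanSpace ℝ (Fin 3)))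
          finrank_euclideanSpace_fin 1) ^ (3 : ℝ) := by
  rw [inter_eq_right.2 (ball_subset_fast ht), ← setLIntegral_const]
  refine setLIntegral_mono' measurableSet_ball fun x _ => ?_
  rw [fderiv_junkVel_of_neg ht.2]
  exact ENNReal.rpow_le_rpow (ENNReal.ofReal_le_ofReal (le_strainEigenvalues_smul_strainB _))
    (by norm_num)

/-! ## The stub is false -/

/-- **`stub_pointSqueeze_of_subscale` is false as registered** (negative-time junk; misstated —
repair: `0 ≤ τ`). Witness `ν = T = 1`, `u = junkVel` (rest state on `t ≥ 0`, `(−t)⁻¹ B x` on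
`t < 0`), `p = 0`, `x₀ = 3e₀`, `r = R = 1`, `τ = −1`, `l = 1`, `q = 3`: the subscale functional is
`0`, the full one is `∞` (integrand `≥ c (−t)⁻²` on `(−1, 0)`).
[cite: MajdaBertozzi2002, §1.4 (exact solutions with linear velocity field)] -/
theorem stub_pointSqueeze_of_subscale_false :
    ¬ (∀ (ν T : ℝ), 0 < ν → 0 < T → ∀ (u : ℝ → EuclideanSpace ℝ (Fin 3) → EuclideanSpace ℝ (Fin 3)) (p : ℝ → EuclideanSpace ℝ (Fin 3) → ℝ), Literature.Analysis.FluidPDE.IsClassicalNSSolutionOn (Set.Ico 0 T) ν 0 u p → Literature.Analysis.FluidPDE.IsLerayHopfOn T ν 0 (u 0) u → ∀ (x₀ : EuclideanSpace ℝ (Fin 3)) (r R τ l q : ℝ), 0 < l → 3 ≤ q → ∫⁻ t in Set.Ioo τ T, (∫⁻ x in {x : EuclideanSpace ℝ (Fin 3) | l < ‖u t x‖} ∩ Metric.ball x₀ r, ENNReal.ofReal (Literature.Analysis.FluidPDE.strainEigenvalues ((fderiv ℝ (u t) x - ⨍ y in Metric.closedBall x R, fderiv ℝ (u t) y : EuclideanSpace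 ℝ (Fin 3) →L[ℝ] EuclideanSpace ℝ (Fin 3)) : EuclideanSpace ℝ (Fin 3) →ₗ[ℝ] EuclideanSpace ℝ (Fin 3)) finrank_euclideanSpace_fin 1) ^ q) ^ (2 / (2 * q - 3)) < ⊤ → ∫⁻ t in Set.Ioo τ T, (∫⁻ x in {x : EuclideanSpace ℝ (Fin 3) | l < ‖u t x‖} ∩ Metric.ball x₀ r, ENNReal.ofReal (Literature.Analysis.FluidPDE.strainEigenvalues ((fderiv ℝ (u t) x : EuclideanSpace ℝ (Fin 3) →L[ℝ] EuclideanSpace ℝ (Fin 3)) : EuclideanSpace ℝ (Fin 3) →ₗ[ℝ] EuclideanSpace ℝ (Fin 3)) finrank_euclideanSpace_fin 1) ^ q) ^ (2 / (2 * q - 3)) < ⊤) := by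
  intro h
  have hexp : (0 : ℝ) < 2 / (2 * 3 - 3) := by norm_num
  -- the hypothesis functional of the witness vanishes identically (subscale gradient ≡ 0)
  have hzero : ∀ (t : ℝ) (x : (EuclideanSpace ℝ (Fin 3))), ENNReal.ofReal (strainEigenvalues
      ((fderiv ℝ (junkVel t) x - ⨍ y in closedBall x (1 : ℝ), fderiv ℝ (junkVel t) y :
        (EuclideanSpace ℝ (Fin 3)) →L[ℝ] (EuclideanSpace ℝ (Fin 3))) : (EuclideanSpace ℝ (Fin 3)) →ₗ[ℝ] (EuclideanSpace ℝ (Fin 3))) finrank_euclideanSpace_fin 1) ^ (3 : ℝ) = 0 := by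
    intro t x
    rw [fderiv_junkVel_sub_setAverage t x one_pos, ContinuousLinearMap.toLinearMap_zero,
      ENNReal.ofReal_of_nonpos strainEigenvalues_zero_mid_le, ENNReal.zero_rpow_of_pos (by norm_num)]
  have hhyp : ∫⁻ t in Set.Ioo (-1 : ℝ) 1, (∫⁻ x in {x : (EuclideanSpace ℝ (Fin 3)) | 1 < ‖junkVel t x‖} ∩ ball fastCentre 1,
      ENNReal.ofReal (strainEigenvalues
        ((fderiv ℝ (junkVel t) x - ⨍ y in closedBall x (1 : ℝ), fderiv ℝ (junkVel t) y :
          (EuclideanSpace ℝ (Fin 3)) →L[ℝ] (EuclideanSpace ℝ (Fin 3))) : (EuclideanSpace ℝ (Fin 3)) →ₗ[ℝ] (EuclideanSpace ℝ (Fin 3))) finrank_euclideanSpace_fin 1) ^ (3 : ℝ)) ^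
        (2 / (2 * 3 - 3) : ℝ) < ⊤ := by
    simp only [hzero, lintegral_const, zero_mul, ENNReal.zero_rpow_of_pos hexp]
    exact ENNReal.zero_lt_top
  have key := h 1 1 one_pos one_pos junkVel 0 (junkVel_isClassical 1) (junkVel_isLerayHopf 1)
    fastCentre 1 1 (-1) 1 3 one_pos le_rfl hhyp
  -- the conclusion functional of the witness is infinite
  revert key
  rw [imp_false, not_lt, top_le_iff]
  apply ENNReal.eq_top_of_forall_nnreal_le
  intro c
  -- constants: the fast ball's volume and the integrand's lower bound
  have hV0 : volume (ball fastCentre 1) ≠ 0 := (measure_ball_pos volume fastCentre one_pos).ne'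
  have hVtop : volume (ball fastCentre 1) ≠ ⊤ := measure_ball_lt_top.ne
  set V' : ℝ≥0∞ := volume (ball fastCentre 1) ^ (2 / 3 : ℝ) with hV'
  have hV'0 : V' ≠ 0 := (ENNReal.rpow_pos (pos_iff_ne_zero.2 hV0) hVtop).ne'
  have hV'top : V' ≠ ⊤ := ENNReal.rpow_ne_top_of_nonneg (by norm_num) hVtop
  have hvpos : 0 < V'.toReal := ENNReal.toReal_pos hV'0 hV'top
  -- the time window `(−ε, 0)`
  set ε : ℝ := min 1 (V'.toReal / ((c : ℝ) + 1)) with hε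
  have hε0 : 0 < ε := lt_min one_pos (div_pos hvpos (by positivity))
  have hε1 : ε ≤ 1 := min_le_left _ _
  have hεv : ε ≤ V'.toReal / ((c : ℝ) + 1) := min_le_right _ _
  -- pointwise lower bound of the conclusion's integrand on the window
  have hG : ∀ t ∈ Ioo (-ε) (0 : ℝ), ENNReal.ofReal (ε⁻¹) ^ (2 : ℝ) * V' ≤
      (∫⁻ x in {x : (EuclideanSpace ℝ (Fin 3)) | 1 < ‖junkVel t x‖} ∩ ball fastCentre 1,
        ENNReal.ofReal (strainEigenvalues ((fderiv ℝ (junkVel t) x : (EuclideanSpace ℝ (Fin 3)) →L[ℝ] (EuclideanSpace ℝ (Fin 3))) : (EuclideanSpace ℝ (Fin 3)) →ₗ[ℝ] (EuclideanSpace ℝ (Fin 3)))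
          finrank_euclideanSpace_fin 1) ^ (3 : ℝ)) ^ (2 / (2 * 3 - 3) : ℝ) := by
    intro t ht
    have ht' : t ∈ Ioo (-1 : ℝ) 0 := ⟨by linarith [ht.1], ht.2⟩
    have hte : ENNReal.ofReal (ε⁻¹) ≤ ENNReal.ofReal ((-t)⁻¹) :=
      ENNReal.ofReal_le_ofReal (inv_anti₀ (neg_pos.2 ht.2) (by linarith [ht.1]))
    have h23 : (2 / (2 * 3 - 3) : ℝ) = 2 / 3 := by norm_num
    calc ENNReal.ofReal (ε⁻¹) ^ (2 : ℝ) * V'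
        = (ENNReal.ofReal (ε⁻¹) ^ (3 : ℝ) * volume (ball fastCentre 1)) ^ (2 / 3 : ℝ) := by
          rw [hV', ENNReal.mul_rpow_of_nonneg _ _ (by norm_num : (0 : ℝ) ≤ 2 / 3),
            ← ENNReal.rpow_mul]
          norm_num
      _ ≤ (ENNReal.ofReal ((-t)⁻¹) ^ (3 : ℝ) * volume (ball fastCentre 1)) ^ (2 / 3 : ℝ) := by
          gcongr
      _ ≤ _ := by
          rw [h23]
          exact ENNReal.rpow_le_rpow (inner_lower_bound ht') (by norm_num)
  -- integrate the lower bound over the window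
  calc (c : ℝ≥0∞) ≤ ENNReal.ofReal (ε⁻¹ * V'.toReal) := by
        rw [← ENNReal.ofReal_coe_nnreal]
        refine ENNReal.ofReal_le_ofReal ?_
        rw [le_inv_mul_iff₀ hε0]
        rw [le_div_iff₀ (by positivity)] at hεv
        nlinarith [hε0, hεv]
    _ = ENNReal.ofReal (ε⁻¹) ^ (2 : ℝ) * V' * volume (Ioo (-ε) (0 : ℝ)) := by
        have hreal : ε⁻¹ * V'.toReal = ε⁻¹ ^ (2 : ℕ) * V'.toReal * ε := by
          field_simp
        rw [hreal, ENNReal.ofReal_mul (by positivity), ENNReal.ofReal_mul (by positivity),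
          ENNReal.ofReal_toReal hV'top, Real.volume_Ioo, sub_neg_eq_add, zero_add,
          ← Real.rpow_natCast, ENNReal.ofReal_rpow_of_nonneg (by positivity) (by norm_num)]
        norm_num
    _ = ∫⁻ _ in Ioo (-ε) (0 : ℝ), ENNReal.ofReal (ε⁻¹) ^ (2 : ℝ) * V' :=
        (setLIntegral_const _ _).symm
    _ ≤ ∫⁻ t in Ioo (-ε) (0 : ℝ), (∫⁻ x in {x : (EuclideanSpace ℝ (Fin 3)) | 1 < ‖junkVel t x‖} ∩ ball fastCentre 1,
          ENNReal.ofReal (strainEigenvalues ((fderiv ℝ (junkVel t) x : (EuclideanSpace ℝ (Fin 3)) →L[ℝ] (EuclideanSpace ℝ (Fin 3))) : (EuclideanSpace ℝ (Fin 3)) →ₗ[ℝ] (EuclideanSpace ℝ (Fin 3)))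
            finrank_euclideanSpace_fin 1) ^ (3 : ℝ)) ^ (2 / (2 * 3 - 3) : ℝ) :=
        setLIntegral_mono' measurableSet_Ioo hG
    _ ≤ _ := lintegral_mono_set (Ioo_subset_Ioo (by linarith) zero_le_one)

end Summit.NavierStokesRegularity.NavierStokesRegularity.Theorems.FastClassSqueeze.Negative

end
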